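import Literature.MathematicalPhysics.KineticTheory.EvenCollisionTubeFunctional
import Literature.MathematicalPhysics.KineticTheory.HardSphereEulerProofs
import HarnessLib

/-!
# The contact theorem for the hard-sphere gas: the canonical pair law at contact and the equation of state

Topic `Literature/MathematicalPhysics/StatisticalMechanics` (DRAFT by the line lead of crux stmt-AtomisticToContinuum-13079,
`JParityClosure.EvenStressEnskog`; NOT YET PROPOSED — sources to be re-read when the literature service is back).

NAMED FACT (D-0014) `HardSphereContactTheorem`: for the canonical ensemble of `n = N + 1` hard spheres of diameter
`ε_N = σ (N+1)^{-1/3}` on the unit flat torus `𝕋³` (uniform activity; the configurational measure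
`posGibbsMeasure 1 ε_N (N+1)` of `HardSphereEulerProofs`) at small reduced density `η = σ³`, the law of the rescaled relative
position `ε_N⁻¹ (x_i − x_j)` of two labelled spheres, restricted to thin shells `{1 < ‖q‖ ≤ 1 + δ}` just outside contact, is
asymptotically `Y(σ³)` times Lebesgue measure, UNIFORMLY over measurable subsets of the shell, where
`Y(η) = (3/2π) f_ex′(η)` is the thermodynamic contact value (`contactValue`, `EvenCollisionTubeFunctional.lean`):
for every `ζ > 0` there is `δ₁ > 0` such that for `0 < δ ≤ δ₁`, all large `N`, all `i ≠ j` and all measurable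
`S ⊆ {1 < ‖q‖ ≤ 1 + δ}`,
`|P_N(ε⁻¹ reprSym(x_i − x_j) ∈ S) − Y(σ³) ε³ vol(S)| ≤ ζ ε³ vol(S)`.

This is the conjunction of two classical statements: (i) the VIRIAL / CONTACT THEOREM of the hard-sphere fluid,
`βP/ρ = 1 + (2π/3) ρ d³ g(d⁺)` (Hansen–McDonald, *Theory of Simple Liquids*, §2.5), together with the thermodynamic identity
`βP/ρ = Z(η) = 1 + η f_ex′(η)` (`hsCompressibility`), so that the contact value of the infinite-volume pair correlation is
`g(d⁺) = (3/2π) f_ex′(η)`; and (ii) the thermodynamic limit of the canonical two-point correlation function at low density,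
uniformly near contact, with finite-volume corrections `O(1/N)` (cluster expansion in the canonical ensemble:
Pulvirenti–Tsagkarogiannis 2012 for the free energy; Kuna–Tsagkarogiannis 2016 and Pulvirenti–Tsagkarogiannis 2015 for the
correlation functions and finite-volume corrections).  The statement below is the special case the crux line needs
(unit torus, uniform activity, shells of rescaled width `δ → 0` after `N → ∞`).
-- TODO(general form): convergence of all canonical correlation functions `ρ_m^{(N)}(ε_N ·)/ (N+1)^m → ρ^m g_m(·; η)`
-- locally uniformly away from contact hyperplanes, with the cluster-expansion radius of [PulvirentiTsagkarogiannis2012].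

## References
* J.-P. Hansen, I. R. McDonald, *Theory of Simple Liquids*, 4th ed. (2013), §2.5 (virial equation, contact value of `g`).
  [HansenMcdonald2013]
* E. Pulvirenti, D. Tsagkarogiannis, Comm. Math. Phys. 316 (2012) 289–306 (cluster expansion in the canonical ensemble).
  [PulvirentiTsagkarogiannis2012]
* E. Pulvirenti, D. Tsagkarogiannis, J. Stat. Phys. 159 (2015) 1017–1039 (finite volume corrections, decay of correlations).
  [PulvirentiTsagkarogiannis2015]
* T. Kuna, D. Tsagkarogiannis, arXiv:1611.01716 (convergence of density expansions of correlation functions).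
  [KunaTsagkarogiannis2016]
-/

noncomputable section

open MeasureTheory Set
open scoped ENNReal Pointwise

namespace Literature.MathematicalPhysics.StatisticalMechanics

open Literature.Analysis.FluidPDE Literature.MathematicalPhysics.KineticTheory

/-- **The contact theorem for the canonical hard-sphere gas on `𝕋³` at low density** (named fact; see the module docstring):
the rescaled near-contact pair law of `N + 1` uniform hard spheres of diameter `hsDiameter σ N` under the configurational
canonical measure is, uniformly on thin shells `{1 < ‖q‖ ≤ 1 + δ}`, the thermodynamic contact value
`contactValue (σ³) = (3/2π)·f_ex′(σ³)` times Lebesgue measure, up to a relative error `ζ` (`N → ∞` first, then `δ → 0`).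
[cite: HansenMcdonald2013, §2.5] -/
def HardSphereContactTheorem : Prop :=
    ∃ σ₁ : ℝ, 0 < σ₁ ∧ ∀ σ : ℝ, 0 < σ → σ < σ₁ → ∀ ζ : ℝ, 0 < ζ → ∃ δ₁ : ℝ, 0 < δ₁ ∧ ∀ δ : ℝ, 0 < δ → δ ≤ δ₁ →
      ∃ N₀ : ℕ, ∀ N : ℕ, N₀ ≤ N →
      ∀ i j : Fin (N + 1), i ≠ j → ∀ S : Set V3, MeasurableSet S → S ⊆ {q | 1 < ‖q‖ ∧ ‖q‖ ≤ 1 + δ} →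
        |(posGibbsMeasure (fun _ => (1 : ℝ)) (hsDiameter σ N) (N + 1)).real
            {x | Torus.reprSym (x i - x j) ∈ hsDiameter σ N • S}
          - contactValue (σ ^ 3) * hsDiameter σ N ^ 3 * (volume S).toReal|
          ≤ ζ * hsDiameter σ N ^ 3 * (volume S).toReal

end Literature.MathematicalPhysics.StatisticalMechanics

end
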